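import Summits.BirchSwinnertonDyer.Rank1Residual.Additive.X4RankZeroKatoBoundManinFree
import Summits.BirchSwinnertonDyer.Rank1Residual.Additive.X4SharpThreeAssembly
import HarnessLib

/-!
# X4 ∧ `r = 0` at an additive potentially good odd `p`: the typed UPPER half `ord_p #Ш ≤ ord_p #Ш_an`
# with NO Tamagawa hypothesis, NO defect, NO parity binder and NO parametrisation datum, from the
# TAMAGAWA-EXACT Kato reading A161″ — and `BSD(E,p)` from the LOWER half alone
# (cell `b2b-bsdres`, team n1011, row T-GSHARP FILE 6; seat p04 GEN 12; lit-kato GEN 25's signed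
# cross-walk `HOME/b2b-bsdres-lit-kato/UTAM-CROSSWALK-gen25.md` §3 "Part B binds A161″ by name")

HONEST FRAMING (cell `b2b-bsdres`, run/shared/lean/b2b/bsd-rank1-residual/, verbatim in every
file): the goal of the cell is to DELETE the COMBINATION-SHAPED residual classes of the
Birch–Swinnerton-Dyer formula for ALL analytic-rank `≤ 1` elliptic curves over `ℚ` — "full BSD
formula for every rank `≤ 1` curve in class `C`" assembled STRICTLY from published theorems — so
that the rank-`≤ 1` remainder becomes exactly the CONSTRUCTION-SHAPED classes, which are TYPED
(missing-input `Prop`s), NOT attempted. This is not "finishing BSD". Team n1011 (N10 / N11, the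
additive block X4 ∧ `p = 3`): research route on the CONSTRUCTION-SHAPED class X4; no claim beyond
the stated classes; nothing is booked; no mark / label / count is changed by this file. Theorems
only (no definition, no new named fact, no `sorry`). Every theorem is CONDITIONAL on the displayed
named fact A161″ `Kato2004.rankZero_padicValNat_sha_add_padicValNat_tamagawa_le_of_additive_potGood_of_imageContainsSL2`
(K. Kato, Astérisque 295 (2004) Thm. 14.5 (3) + Prop. 14.16 (2) + §14.8, with R. Greenberg, LNM 1716
(1999) Prop. 4.13 / Lemma 3.3 for the exact index `[S(T) : Sel(T)] = ∏_{ℓ≠p} c_ℓ^{(p)}`; typed and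
audited by the literature seat lit-kato GEN 24, `KATO2004-TYPING.md` §29; landed p320328) plus
Gross–Zagier–Kolyvagin `hGZK` and modularity `hmod`; the `BSD(E,p)` statements need the LOWER half
(`MissingLowerBoundAt`, any producer) or a visible element as input and CLOSE NOTHING by themselves.

## What (the `_of_katoTam` twins of additive-p4's `X4RankZeroKatoBoundSharp` / `…ManinFree` core
and of T-GSHARP FILE 1 §1 / FILE 4 §0; every odd `p`)

The (G) upper halves used so far carry a Tamagawa price: `¬ p ∣ ∏ c_ℓ` (A161), the READING
`ord_p ∏ c_ℓ = ord_p c_p` (A161′ sharp), or DEFECT `≤ 1` with the parity binder `Even (ord_p #Ш_an)`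
(T-GSHARP FILES 1–4). A161″ bounds `ord_p #Ш(p) + v_p(Tam(E))` by `ord_p(L(E,1)/Ω)` — the full `p`-part
of the BSD upper half in rank `0` — so all three prices disappear:
* `X4RankZero.missingUpperBoundAt_of_katoTam` — X4 ∧ `r_an = 0` ∧ `ord_p j ≥ 0` ∧ `ρ̄_{E,p^n}` onto
  for all `n` ⟹ `MissingUpperBoundAt W p` (NO Tamagawa / Manin / parity binder);
* `X4RankZero.bsdp_of_missingLowerBoundAt_of_katoTam` — the same + `MissingLowerBoundAt W p` ⟹
  `BSD(E,p)`;
* `X4RankZero.bsdp_of_exists_sha_torsion_of_katoTam` — the same + `#Ш_an = q`, `ord_p q ≤ 2`, a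
  visible `c ∈ Ш(E)[p] ∖ 0` (Cassels–Tate `hCT`) ⟹ `BSD(E,p)` (kind-agnostic visibility END);
* `X4RankZero.bsdp_of_shaAn_unit_of_katoTam` — the same + `p ∤ #Ш_an` ⟹ `BSD(E,p)` (the unit rows:
  `Ш(E)[p^∞] = 0`), and its `p = 3` census shape `X4RankZero.bsdp_three_of_katoTam_of_surj_of_cert`
  (tower by a `j`-witness or surj(9), `GaloisImage/JWitnessTowerSurjectivity`), and the `p ≥ 5` shape
  `X4RankZero.bsdp_of_katoTam_of_surj_of_five_le` (tower by Serre).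
EVIDENCE (census `HOME/b2b-bsdres-n1011-p04/gen12/census/gsharp_defect_rows.tsv`): at `p = 3` the 526
potentially good N11 visibility rows with `3 ∣ ∏ c_ℓ` ALL get the upper half here (T-GSHARP FILES 1–4
served 500; the 24 rows of defect `≥ 2` were a located gap); the 2 rows with `ord₃ #Ш_an = 4` still
lack a LOWER half (`3⁴ ∣ #Ш` is not one visible element). Nothing booked; X4 stays CONSTRUCTION-SHAPED.

References: [Kato2004Asterisque] Thm. 14.5 (3) (p. 236), Prop. 14.16 (2) (p. 244), §14.8 (p. 238);
[GreenbergLNM1716] §4 Prop. 4.13, §3 Lemma 3.3; [SilvermanAEC2009] X.4.14; [Miller2011LMS] Def. 1.1;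
[Mazur1977] III.5; `HOME/b2b-bsdres-n1011-p04/gen12/UTAM-NOTE.md`, lit-kato `UTAM-CROSSWALK-gen25.md`.
-/

noncomputable section

open scoped Classical

namespace Summit.BirchSwinnertonDyer.Rank1Residual.Additive

open WeierstrassCurve Literature.NumberTheory.EllipticCurves
  Literature.NumberTheory.EllipticCurves.ModularForms
  Literature.NumberTheory.EllipticCurves.Rank1Residual
  Literature.NumberTheory.EllipticCurves.Rank1Residual.Typed

variable (W : WeierstrassCurve ℚ) [W.IsElliptic] [W.IsGloballyMinimal] (p : ℕ) [Fact p.Prime]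

/-! ### §1 The rank-`0` upper bound with the torsion term, from the Tamagawa-exact reading -/

/-- **Rank-`0` upper bound from A161″ with the torsion term**: `#Ш_an = q` and
`ord_p #Ш ≤ ord_p q − 2 ord_p #E(ℚ)_tors` at every odd additive potentially good `p` with (12.5.2) —
NO Tamagawa term (`#Ш_an = (L/Ω)·#tors²/∏c_ℓ` and A161″ bounds `ord_p #Ш + v_p(∏c_ℓ)` by `ord_p(L/Ω)`).
[cite: Kato2004Asterisque, Thm. 14.5 (3) (p. 236), Prop. 14.16 (2) (p. 244), §14.8 (p. 238)]
[cite: GreenbergLNM1716, §4 Prop. 4.13; §3 Lemma 3.3] [cite: Miller2011LMS, Def. 1.1] -/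
theorem padicValNat_shaOrder_le_of_katoTam_rankZero
    (hKatoT : Kato2004.rankZero_padicValNat_sha_add_padicValNat_tamagawa_le_of_additive_potGood_of_imageContainsSL2)
    (hGZK : rank_eq_analyticRank_of_analyticRank_le_one) (hmod : hasEntireLFunction_rat)
    (hp : p ≠ 2) (hgood : ¬ W.HasGoodReductionAtPrime p) (hmult : ¬ W.HasMultiplicativeReductionAtPrime p)
    (hpot : 0 ≤ padicValRat p W.j) (hbig : Kato2004.ImageContainsSL2 W p) (hr : W.analyticRank = 0) :
    ∃ q : ℚ, shaAn W = (q : ℂ) ∧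
      (padicValNat p W.shaOrder : ℤ) ≤ padicValRat p q - 2 * padicValNat p W.torsionOrder := by
  have hL : W.entireLFunction 1 ≠ 0 := (W.analyticRank_eq_zero_iff_holds (hmod W)).mp hr
  obtain ⟨hmw, hfin⟩ := hGZK W (by rw [hr]; exact zero_le_one)
  haveI : Finite W.sha := hfin
  have hmw0 : W.mordellWeilRank = 0 := by rw [hmw, hr]
  obtain ⟨q₀, hq₀, hle⟩ := hKatoT W p hp hgood hmult hpot hbig hL hfin
  have hΩpos : 0 < W.realPeriodRat := W.realPeriodRat_pos_holds
  have hΩ : (W.realPeriodRat : ℂ) ≠ 0 := by exact_mod_cast hΩpos.ne'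
  have hc0 : 0 < W.tamagawaProduct := W.tamagawaProduct_pos_holds
  have ht0 : 0 < W.torsionOrder := W.torsionOrder_pos_holds
  have hq₀0 : q₀ ≠ 0 := by
    rintro rfl
    rw [Rat.cast_zero, div_eq_zero_iff] at hq₀
    exact hq₀.elim hL hΩ
  refine ⟨q₀ * (W.torsionOrder : ℚ) ^ 2 / (W.tamagawaProduct : ℚ), ?_, ?_⟩
  · have hLq : W.entireLFunction 1 = (q₀ : ℂ) * (W.realPeriodRat : ℂ) := by
      rw [← hq₀, div_mul_cancel₀ _ hΩ]
    rw [shaAn_def, leadingLCoeff_eq_of_analyticRank_eq_zero W hr,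
      W.regulator_eq_one_of_rank_zero hmw0, hLq]
    push_cast
    field_simp
  · have ht : (W.torsionOrder : ℚ) ≠ 0 := by exact_mod_cast ht0.ne'
    have hcq : (W.tamagawaProduct : ℚ) ≠ 0 := by exact_mod_cast hc0.ne'
    have hsha : padicValNat p (Nat.card (AddCommGroup.primaryComponent W.sha p)) =
        padicValNat p W.shaOrder := by
      unfold WeierstrassCurve.shaOrder
      exact padicValNat_card_addPrimaryComponent p
    have hv : padicValRat p (q₀ * (W.torsionOrder : ℚ) ^ 2 / (W.tamagawaProduct : ℚ)) =
        padicValRat p q₀ + 2 * (padicValNat p W.torsionOrder : ℤ) -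
          (padicValNat p W.tamagawaProduct : ℤ) := by
      rw [padicValRat.div (mul_ne_zero hq₀0 (pow_ne_zero 2 ht)) hcq,
        padicValRat.mul hq₀0 (pow_ne_zero 2 ht), pow_two, padicValRat.mul ht ht,
        padicValRat.of_nat, padicValRat.of_nat]
      ring
    rw [hv, ← hsha]
    linarith

/-! ### §2 X4 ∧ `r = 0`: the typed UPPER half and `BSD(E,p)` from the lower half, no Tamagawa price -/

/-- **THE TYPED UPPER HALF WITHOUT ANY TAMAGAWA, MANIN OR PARITY BINDER**: X4 ∧ `r_an = 0` ∧
`ord_p j ≥ 0` ∧ `ρ̄_{E,p^n}` onto for all `n` ⟹ `MissingUpperBoundAt W p` (`ord_p #Ш ≤ ord_p #Ш_an`;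
torsion term killed by irreducibility). The `_of_katoTam` twin of additive-p4's
`X4RankZero.missingUpperBoundAt_of_katoSharp` (whose `htam : ord_p ∏c_ℓ = ord_p c_p` is gone).
[cite: Kato2004Asterisque, Thm. 14.5 (3) (p. 236), Prop. 14.16 (2) (p. 244), §14.8 (p. 238), (12.5.2) (p. 222)]
[cite: GreenbergLNM1716, §4 Prop. 4.13; §3 Lemma 3.3] [cite: Mazur1977, Ch. III §5, p. 157] [cite: Miller2011LMS, Def. 1.1] -/
theorem X4RankZero.missingUpperBoundAt_of_katoTam
    (hKatoT : Kato2004.rankZero_padicValNat_sha_add_padicValNat_tamagawa_le_of_additive_potGood_of_imageContainsSL2)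
    (hGZK : rank_eq_analyticRank_of_analyticRank_le_one) (hmod : hasEntireLFunction_rat)
    (hr : W.analyticRank = 0) (hX : ClassX4 W p) (hpot : 0 ≤ padicValRat p W.j)
    (hsurj : ∀ n : ℕ, W.HasSurjectiveModNGaloisRep (p ^ n : ℕ)) :
    MissingUpperBoundAt W p := by
  obtain ⟨hp2, ⟨hgood, hmult⟩, hirr⟩ := hX
  obtain ⟨q, hq, hle⟩ :=
    padicValNat_shaOrder_le_of_katoTam_rankZero W p hKatoT hGZK hmod hp2 hgood hmult hpot
      (Kato2004.imageContainsSL2_of_forall_hasSurjectiveModNGaloisRep W p hsurj) hr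
  refine ⟨q, hq, ?_⟩
  rw [padicValNat_torsionOrder_eq_zero_of_irreducible W p hirr] at hle
  simpa using hle

/-- **`BSD(E,p)` from the LOWER half alone, no Tamagawa price**: X4 ∧ `r_an = 0` ∧ `ord_p j ≥ 0` ∧
`ρ̄_{E,p^n}` onto for all `n` ∧ `MissingLowerBoundAt W p` ⟹ `BSD(E,p)`. The `_of_katoTam` twin of p03's
`X4RankZero.bsdp_of_missingLowerBoundAt_of_kato` / T-GSHARP FILE 1's `…_of_katoSharp[…]`.
[cite: Kato2004Asterisque, Thm. 14.5 (3) (p. 236), Prop. 14.16 (2) (p. 244), §14.8 (p. 238)]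
[cite: GreenbergLNM1716, §4 Prop. 4.13] [cite: Miller2011LMS, §1 and Def. 1.1] -/
theorem X4RankZero.bsdp_of_missingLowerBoundAt_of_katoTam
    (hKatoT : Kato2004.rankZero_padicValNat_sha_add_padicValNat_tamagawa_le_of_additive_potGood_of_imageContainsSL2)
    (hGZK : rank_eq_analyticRank_of_analyticRank_le_one) (hmod : hasEntireLFunction_rat)
    (hr : W.analyticRank = 0) (hX : ClassX4 W p) (hpot : 0 ≤ padicValRat p W.j)
    (hsurj : ∀ n : ℕ, W.HasSurjectiveModNGaloisRep (p ^ n : ℕ))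
    (hlow : MissingLowerBoundAt W p) : BSDp W p :=
  bsdp_of_missingPPartAt W p hGZK (by rw [hr]; exact zero_le_one)
    (missingPPartAt_of_lower_of_upper W p hlow
      (X4RankZero.missingUpperBoundAt_of_katoTam W p hKatoT hGZK hmod hr hX hpot hsurj))

/-- **`BSD(E,p)` from ANY visible element of `Ш(E)[p]`, no Tamagawa price** (kind-agnostic visibility
END; the `_of_katoTam` twin of p14's `X4RankZero.bsdp_of_exists_sha_torsion_of_kato` / FILE 4 §0, same binder
order — facts, then `W p`): X4 ∧
`r_an = 0` ∧ `ord_p j ≥ 0` ∧ tower onto ∧ `#Ш_an = q` with `ord_p q ≤ 2` ∧ `∃ c ∈ Ш(E)`, `c ≠ 0`,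
`p • c = 0` ⟹ `BSD(E,p)` (`p² ∣ #Ш` by Cassels–Tate `hCT`). [cite: Kato2004Asterisque, Thm. 14.5 (3) (p. 236), Prop. 14.16 (2) (p. 244), §14.8 (p. 238)]
[cite: GreenbergLNM1716, §4 Prop. 4.13] [cite: SilvermanAEC2009, Thm. X.4.14] [cite: Miller2011LMS, §1 and Def. 1.1] -/
theorem X4RankZero.bsdp_of_exists_sha_torsion_of_katoTam
    (hKatoT : Kato2004.rankZero_padicValNat_sha_add_padicValNat_tamagawa_le_of_additive_potGood_of_imageContainsSL2)
    (hCT : exists_casselsTate_pairing (K := ℚ))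
    (hGZK : rank_eq_analyticRank_of_analyticRank_le_one) (hmod : hasEntireLFunction_rat)
    (W : WeierstrassCurve ℚ) [W.IsElliptic] [W.IsGloballyMinimal] (p : ℕ) [Fact p.Prime]
    (hr : W.analyticRank = 0) (hX : ClassX4 W p) (hpot : 0 ≤ padicValRat p W.j)
    (hsurj : ∀ n : ℕ, W.HasSurjectiveModNGaloisRep (p ^ n : ℕ))
    {q : ℚ} (hq : shaAn W = (q : ℂ)) (hv : padicValRat p q ≤ 2)
    (hvis : ∃ c : W.sha, c ≠ 0 ∧ p • c = 0) : BSDp W p := by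
  have hlow : MissingLowerBoundAt W p :=
    missingLowerBoundAt_of_casselsTate_of_pow_dvd W p hCT (hGZK W (by omega)).2 hq (k := 1)
      (by simpa using hv) (by simpa using dvd_shaOrder_of_exists_torsion W p hvis)
  exact X4RankZero.bsdp_of_missingLowerBoundAt_of_katoTam W p hKatoT hGZK hmod hr hX hpot hsurj hlow

/-! ### §3 The unit rows: `p ∤ #Ш_an ⟹ Ш(E)[p^∞] = 0` and `BSD(E,p)`, whatever the Tamagawa numbers -/

/-- **`BSD(E,p)` on the `#Ш_an`-UNIT rows, no Tamagawa price** (the `_of_katoTam` twin of additive-p4's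
`X4RankZero.bsdp_of_shaAn_unit_of_katoSharp` / `…_of_katoSharp_of_casselsTate_of_tamDefect_le_one`): X4 ∧
`r_an = 0` ∧ `ord_p j ≥ 0` ∧ tower onto ∧ `#Ш_an = q` a `p`-unit ⟹ `BSD(E,p)` (`ord_p #Ш ≤ 0`).
At `p = 3` these are additive-p4's V20♯ "upper half only" rows (`3 ∣ ∏_{ℓ≠3} c_ℓ`; lit-kato §9.3:
17 205 sweep pairs) and the parity residue of `X4RankZeroKatoParity` (defect `≥ 2`), now closed like the
others — per pair, labels UNCHANGED, nothing booked. [cite: Kato2004Asterisque, Thm. 14.5 (3) (p. 236), Prop. 14.16 (2) (p. 244), §14.8 (p. 238)]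
[cite: GreenbergLNM1716, §4 Prop. 4.13] [cite: Miller2011LMS, §1 and Def. 1.1] -/
theorem X4RankZero.bsdp_of_shaAn_unit_of_katoTam
    (hKatoT : Kato2004.rankZero_padicValNat_sha_add_padicValNat_tamagawa_le_of_additive_potGood_of_imageContainsSL2)
    (hGZK : rank_eq_analyticRank_of_analyticRank_le_one) (hmod : hasEntireLFunction_rat)
    (hr : W.analyticRank = 0) (hX : ClassX4 W p) (hpot : 0 ≤ padicValRat p W.j)
    (hsurj : ∀ n : ℕ, W.HasSurjectiveModNGaloisRep (p ^ n : ℕ))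
    {q : ℚ} (hq : shaAn W = (q : ℂ)) (hv : padicValRat p q = 0) : BSDp W p := by
  obtain ⟨q', hq', hle⟩ := X4RankZero.missingUpperBoundAt_of_katoTam W p hKatoT hGZK hmod hr hX hpot hsurj
  have hqq : q' = q := by exact_mod_cast hq'.symm.trans hq
  subst hqq
  rw [hv] at hle
  have h0 : padicValNat p W.shaOrder = 0 := by exact_mod_cast le_antisymm hle (by positivity)
  exact bsdp_of_missingPPartAt W p hGZK (by rw [hr]; exact zero_le_one)
    ⟨q', hq', by rw [hv, h0, Nat.cast_zero]⟩

/-- **`p = 3` census shape of the unit-row closure** (surj(3) ∧ [a `j`-witness ∨ surj(9)] feed the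
tower by `towerSurj_three_of_surj_of_jWitness_or_nine`): X4 ∧ `r_an = 0` ∧ `ord₃ j ≥ 0` ∧ surj(3) ∧
[`∃` prime `ℓ ≠ 3`, `ord_ℓ j < 0`, `3 ∤ ord_ℓ j`] ∨ surj(9) ∧ `3 ∤ #Ш_an` ⟹ `BSD(E,3)` — NO `∏ c_ℓ`,
`c₃`, defect, parity or Manin binder. [cite: Kato2004Asterisque, Thm. 14.5 (3) (p. 236), (12.5.2) (p. 222)]
[cite: GreenbergLNM1716, §4 Prop. 4.13] [cite: Miller2011LMS, §1 and Def. 1.1] -/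
theorem X4RankZero.bsdp_three_of_katoTam_of_surj_of_cert
    (hKatoT : Kato2004.rankZero_padicValNat_sha_add_padicValNat_tamagawa_le_of_additive_potGood_of_imageContainsSL2)
    (hGZK : rank_eq_analyticRank_of_analyticRank_le_one) (hmod : hasEntireLFunction_rat)
    (hr : W.analyticRank = 0) (hX : ClassX4 W 3) (hpot : 0 ≤ padicValRat 3 W.j) (hsurj : Surj W 3)
    (hcert : (∃ q : ℕ, q.Prime ∧ q ≠ 3 ∧ padicValRat q W.j < 0 ∧ ¬ (3 : ℤ) ∣ padicValRat q W.j) ∨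
      W.HasSurjectiveModNGaloisRep 9)
    {q : ℚ} (hq : shaAn W = (q : ℂ)) (hv : padicValRat 3 q = 0) : BSDp W 3 :=
  X4RankZero.bsdp_of_shaAn_unit_of_katoTam W 3 hKatoT hGZK hmod hr hX hpot
    (towerSurj_three_of_surj_of_jWitness_or_nine W hsurj hcert) hq hv

/-- **`p ≥ 5` census shape of the unit-row closure, no Tamagawa price** (tower by Serre's lemma,
`serre_hasSurjectiveModNGaloisRep_pow_holds`; the `_of_katoTam` twin of additive-p4's
`X4RankZero.bsdp_of_casselsTate_of_tamDefect_le_one_of_five_le`, whose `¬ p² ∣ ∏ c_ℓ` is gone): X4 ∧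
`r_an = 0` ∧ `ord_p j ≥ 0` ∧ surj(p) ∧ `p ∤ #Ш_an`, `p ≥ 5` ⟹ `BSD(E,p)`.
[cite: Kato2004Asterisque, Thm. 14.5 (3) (p. 236), (12.5.2) (p. 222)] [cite: GreenbergLNM1716, §4 Prop. 4.13]
[cite: SerreAbelianLadic1968, Ch. IV §3.4, Lemma 3] [cite: Miller2011LMS, §1 and Def. 1.1] -/
theorem X4RankZero.bsdp_of_katoTam_of_surj_of_five_le
    (hKatoT : Kato2004.rankZero_padicValNat_sha_add_padicValNat_tamagawa_le_of_additive_potGood_of_imageContainsSL2)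
    (hGZK : rank_eq_analyticRank_of_analyticRank_le_one) (hmod : hasEntireLFunction_rat)
    (hp5 : 5 ≤ p) (hr : W.analyticRank = 0) (hX : ClassX4 W p) (hpot : 0 ≤ padicValRat p W.j)
    (hsurj : Surj W p) {q : ℚ} (hq : shaAn W = (q : ℂ)) (hv : padicValRat p q = 0) : BSDp W p :=
  X4RankZero.bsdp_of_shaAn_unit_of_katoTam W p hKatoT hGZK hmod hr hX hpot
    (serre_hasSurjectiveModNGaloisRep_pow_holds W p hp5 hsurj) hq hv

end Summit.BirchSwinnertonDyer.Rank1Residual.Additive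

end
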